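import Literature.NumberTheory.EllipticCurves.FormalGroupTranslation
import HarnessLib

/-!
# `P₀ + P(t) = (translateX, translateY)` in `E(k⸨t⸩)`: the translation series ARE the coordinates of the translate of the
# formal point by a rational point (de Shalit II.4.9, proof of (i); Silverman AEC III.2.3 / IV.1 — proofs only)

Topic `NumberTheory/EllipticCurves` (theorems only; no definition, no named fact, no instance).  For an elliptic curve `E`
over a field `k`, a point `P₀ = (x₀, y₀) ∈ E(k)` and the formal point `P(t) = (x(t), y(t)) ∈ E(k⸨t⸩)` of parameter `t`
(`laurentPt`, `FormalGroupLaurentPoints`), Mathlib's chord–tangent sum `P₀ + P(t)` in `E(k⸨t⸩)` is the affine point whose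
coordinates are the power series `translateX E x₀ y₀`, `translateY E x₀ y₀ ∈ k⟦t⟧` of `FormalGroupTranslation`
(`some_add_laurentPt`).  This certifies those series as «the `t`-expansion of `x(P₀ + P)`, `y(P₀ + P)` at `P = O`» —
the expansion de Shalit computes in II.4.9 (proof of (i)) for `P₀ = ξ(Ω)` on a CM curve (the function
`P ↦ x(P₀ − P) = ℘(Ω − z) − b₂/12`).  Cell `bsd-print-cf2`, seat `bsd-line-cf2c-w4` g12 (B6 ingredient (ii-α)); no summit
statement is proved.

## References
* [deShalit1987] E. de Shalit, *Iwasawa theory of elliptic curves with complex multiplication* (1987), II §4.9 (proof of (i)).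
* [SilvermanAEC2009] J. H. Silverman, *The Arithmetic of Elliptic Curves*, 2nd ed. (2009), III.2.3, IV.1, VII.2.2.
-/

noncomputable section

open scoped Classical LaurentSeries
open PowerSeries Literature.NumberTheory.EllipticCurves

namespace WeierstrassCurve

variable {k : Type*} [Field k] {E : WeierstrassCurve k}

/-- Coercion `k⟦t⟧ → k⸨t⸩` of an identity of power series (bookkeeping). [folklore] -/
private theorem coe_congr {f g : k⟦X⟧} (h : f = g) : ((f : k⟦X⟧) : k⸨X⸩) = ((g : k⟦X⟧) : k⸨X⸩) := by rw [h]

/-- `X(t)` read at the parameter `t` itself is `X`. [folklore] -/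
private theorem formalXMulSq_subst_X' : E.formalXMulSq.subst (PowerSeries.X : k⟦X⟧) = E.formalXMulSq := by
  rw [← map_algebraMap_eq_subst_X, Algebra.algebraMap_self, PowerSeries.map_id]; rfl

/-- **`x₀ ≠ x(t)`**: a constant is not the `x`-coordinate of the formal point (which has a double pole); quantitatively
`x₀ − x(t) = −D/t²`, `D = X − x₀t² ≠ 0`. [cite: SilvermanAEC2009, IV.1.1] -/
theorem algebraMap_sub_laurentX_X (x₀ : k) :
    algebraMap k k⸨X⸩ x₀ - E.laurentX (PowerSeries.X : k⟦X⟧) =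
      -((E.translateDen x₀ : k⟦X⟧) : k⸨X⸩) / ((PowerSeries.X : k⟦X⟧) : k⸨X⸩) ^ 2 := by
  have ht : ((PowerSeries.X : k⟦X⟧) : k⸨X⸩) ≠ 0 := coe_laurent_ne_zero PowerSeries.X_ne_zero
  rw [laurentX, formalXMulSq_subst_X', translateDen, PowerSeries.coe_sub, PowerSeries.coe_mul, PowerSeries.coe_pow,
    algebraMap_laurentSeries_eq_coe_C]
  field_simp
  ring

/-- `D ≠ 0` in `k⸨t⸩` (`D(0) = 1`). [cite: SilvermanAEC2009, IV.1.1] -/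
theorem coe_translateDen_ne_zero (x₀ : k) : ((E.translateDen x₀ : k⟦X⟧) : k⸨X⸩) ≠ 0 :=
  coe_laurent_ne_zero fun h => by simpa [h] using E.constantCoeff_translateDen x₀

/-- `x₀ ≠ x(t)` in `k⸨t⸩`. [cite: SilvermanAEC2009, IV.1.1] -/
theorem algebraMap_ne_laurentX_X (x₀ : k) : algebraMap k k⸨X⸩ x₀ ≠ E.laurentX (PowerSeries.X : k⟦X⟧) := by
  intro h
  have h' := sub_eq_zero.mpr h
  rw [algebraMap_sub_laurentX_X, div_eq_zero_iff, neg_eq_zero] at h'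
  rcases h' with h' | h'
  · exact coe_translateDen_ne_zero x₀ h'
  · exact pow_ne_zero 2 (coe_laurent_ne_zero PowerSeries.X_ne_zero) h'

/-- `y₀ − y(t) = N/t³`, `N = X + y₀t³`. [cite: SilvermanAEC2009, IV.1.1] -/
theorem algebraMap_sub_laurentY_X (y₀ : k) :
    algebraMap k k⸨X⸩ y₀ - E.laurentY (PowerSeries.X : k⟦X⟧) =
      ((E.translateNum y₀ : k⟦X⟧) : k⸨X⸩) / ((PowerSeries.X : k⟦X⟧) : k⸨X⸩) ^ 3 := by
  have ht : ((PowerSeries.X : k⟦X⟧) : k⸨X⸩) ≠ 0 := coe_laurent_ne_zero PowerSeries.X_ne_zero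
  rw [laurentY, formalXMulSq_subst_X', translateNum, PowerSeries.coe_add, PowerSeries.coe_mul, PowerSeries.coe_pow,
    algebraMap_laurentSeries_eq_coe_C]
  field_simp
  ring

/-- ★ **The chord identity in the `(t, w)`-chart**, `w = t³·B = −1/y`, `x = t/w`: in `k⟦t⟧`,
`x₃·(x₀w − t)²·w = w(y₀w + 1)² + a₁(y₀w + 1)(x₀w − t)w − ((a₂ + x₀)w + t)(x₀w − t)²` for `x₃ = translateX`
(the chord formula `x₃(x₀ − x)² = (y₀ − y)² + a₁(y₀ − y)(x₀ − x) − (a₂ + x₀ + x)(x₀ − x)²` multiplied by `w³`) — the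
polynomial form under which the `t`-expansion is compared with the ANALYTIC Taylor series of `x(P₀ + u(z))` along a complex
uniformisation (`w`, `t` analytic at `z = 0`). [cite: deShalit1987, II §4.9 (proof of (i))] [cite: SilvermanAEC2009, III.2.3, IV.1] -/
theorem translateX_mul_chart_identity (x₀ y₀ : k) :
    E.translateX x₀ y₀ * (C x₀ * E.formalW - PowerSeries.X) ^ 2 * E.formalW =
      E.formalW * (C y₀ * E.formalW + 1) ^ 2 +
        C E.a₁ * (C y₀ * E.formalW + 1) * (C x₀ * E.formalW - PowerSeries.X) * E.formalW -
        (C (E.a₂ + x₀) * E.formalW + PowerSeries.X) * (C x₀ * E.formalW - PowerSeries.X) ^ 2 := by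
  have hinj : Function.Injective (fun f : k⟦X⟧ => (f : k⸨X⸩)) := HahnSeries.ofPowerSeries_injective
  apply hinj
  set t : k⸨X⸩ := ((PowerSeries.X : k⟦X⟧) : k⸨X⸩) with htdef
  set Xs : k⸨X⸩ := ((E.formalXMulSq : k⟦X⟧) : k⸨X⸩) with hXs
  set B : k⸨X⸩ := ((E.formalWDivCube : k⟦X⟧) : k⸨X⸩) with hB
  set D : k⸨X⸩ := ((E.translateDen x₀ : k⟦X⟧) : k⸨X⸩) with hD
  set N : k⸨X⸩ := ((E.translateNum y₀ : k⟦X⟧) : k⸨X⸩) with hN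
  set u : k⸨X⸩ := ((E.translateSlopeNum x₀ y₀ : k⟦X⟧) : k⸨X⸩) with hu
  set G : k⸨X⸩ := ((E.translateXAux x₀ y₀ : k⟦X⟧) : k⸨X⸩) with hG
  set TX : k⸨X⸩ := ((E.translateX x₀ y₀ : k⟦X⟧) : k⸨X⸩) with hTX
  have ht : t ≠ 0 := coe_laurent_ne_zero PowerSeries.X_ne_zero
  have hXs0 : Xs ≠ 0 := coe_laurent_ne_zero fun h => by simpa [h] using E.constantCoeff_formalXMulSq
  have hD0 : D ≠ 0 := coe_translateDen_ne_zero x₀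
  have hBX : B * Xs = 1 := by rw [hB, hXs, ← PowerSeries.coe_mul, E.formalWDivCube_mul_formalXMulSq, PowerSeries.coe_one]
  have hB' : B = 1 / Xs := by rw [eq_div_iff hXs0, hBX]
  have hw : ((E.formalW : k⟦X⟧) : k⸨X⸩) = t ^ 3 * B := by
    rw [E.formalW_eq_X_pow_mul_formalWDivCube, PowerSeries.coe_mul, PowerSeries.coe_pow]
  have i1 : D = Xs - algebraMap k k⸨X⸩ x₀ * t ^ 2 := by
    rw [hD, translateDen, PowerSeries.coe_sub, PowerSeries.coe_mul, PowerSeries.coe_pow, algebraMap_laurentSeries_eq_coe_C]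
  have i2 : N = Xs + algebraMap k k⸨X⸩ y₀ * t ^ 3 := by
    rw [hN, translateNum, PowerSeries.coe_add, PowerSeries.coe_mul, PowerSeries.coe_pow, algebraMap_laurentSeries_eq_coe_C]
  have i3 : u = N / D := by
    rw [eq_div_iff hD0, mul_comm, hD, hu, hN, ← PowerSeries.coe_mul, E.translateDen_mul_translateSlopeNum]
  have i4 : TX = G / t ^ 2 := by
    rw [eq_div_iff (pow_ne_zero 2 ht), mul_comm, htdef, hTX, hG, ← PowerSeries.coe_pow, ← PowerSeries.coe_mul,
      E.X_sq_mul_translateX]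
  have i5 : G = u ^ 2 - algebraMap k k⸨X⸩ E.a₁ * t * u - Xs - algebraMap k k⸨X⸩ (E.a₂ + x₀) * t ^ 2 := by
    rw [hG, translateXAux]
    simp only [PowerSeries.coe_sub, PowerSeries.coe_mul, PowerSeries.coe_pow, algebraMap_laurentSeries_eq_coe_C]
    rfl
  simp only [PowerSeries.coe_mul, PowerSeries.coe_pow, PowerSeries.coe_sub, PowerSeries.coe_add, PowerSeries.coe_one,
    ← algebraMap_laurentSeries_eq_coe_C, hw]
  rw [← htdef, ← hTX, i4, i5, i3, hB', map_add]
  field_simp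
  rw [i1, i2]
  ring

/-- A `k`-point is a `k⸨t⸩`-point (nonsingularity is preserved under the injective base change). [cite: SilvermanAEC2009, III.2.3] -/
theorem nonsingular_algebraMap_laurent {x₀ y₀ : k} (h₀ : E.toAffine.Nonsingular x₀ y₀) :
    (E.baseChange k⸨X⸩).toAffine.Nonsingular (algebraMap k k⸨X⸩ x₀) (algebraMap k k⸨X⸩ y₀) :=
  (Affine.map_nonsingular E.toAffine (algebraMap k k⸨X⸩).injective x₀ y₀).mpr h₀

variable [E.IsElliptic]

/-- ★★ **`P₀ + P(t) = (translateX, translateY)` in `E(k⸨t⸩)`**: for `P₀ = (x₀, y₀) ∈ E(k)` and the formal point `P(t)`,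
the chord–tangent sum is the affine point with coordinates the translation power series of `FormalGroupTranslation`
(chord case, `x₀ ≠ x(t)`; Mathlib's `addX`/`addY` cleared of denominators = the identities `t²·translateX = G`, `D·u = N`,
`t·H = translateX − x₀`). [cite: deShalit1987, II §4.9 Proposition (i) (proof)] [cite: SilvermanAEC2009, III.2.3, IV.1] -/
theorem some_add_laurentPt {x₀ y₀ : k} (h₀ : E.toAffine.Nonsingular x₀ y₀) :
    ∃ h₃ : (E.baseChange k⸨X⸩).toAffine.Nonsingular ((E.translateX x₀ y₀ : k⟦X⟧) : k⸨X⸩)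
        ((E.translateY x₀ y₀ : k⟦X⟧) : k⸨X⸩),
      Affine.Point.some (algebraMap k k⸨X⸩ x₀) (algebraMap k k⸨X⸩ y₀) (nonsingular_algebraMap_laurent h₀) +
        E.laurentPt (PowerSeries.X : k⟦X⟧) PowerSeries.constantCoeff_X =
      Affine.Point.some _ _ h₃ := by
  -- names
  set t : k⸨X⸩ := ((PowerSeries.X : k⟦X⟧) : k⸨X⸩) with htdef
  set Xs : k⸨X⸩ := ((E.formalXMulSq : k⟦X⟧) : k⸨X⸩) with hXs
  set D : k⸨X⸩ := ((E.translateDen x₀ : k⟦X⟧) : k⸨X⸩) with hD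
  set N : k⸨X⸩ := ((E.translateNum y₀ : k⟦X⟧) : k⸨X⸩) with hN
  set u : k⸨X⸩ := ((E.translateSlopeNum x₀ y₀ : k⟦X⟧) : k⸨X⸩) with hu
  set G : k⸨X⸩ := ((E.translateXAux x₀ y₀ : k⟦X⟧) : k⸨X⸩) with hG
  set TX : k⸨X⸩ := ((E.translateX x₀ y₀ : k⟦X⟧) : k⸨X⸩) with hTX
  set H : k⸨X⸩ := ((E.translateXSubDivX x₀ y₀ : k⟦X⟧) : k⸨X⸩) with hH
  set TY : k⸨X⸩ := ((E.translateY x₀ y₀ : k⟦X⟧) : k⸨X⸩) with hTY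
  have ht : t ≠ 0 := coe_laurent_ne_zero PowerSeries.X_ne_zero
  have hD0 : D ≠ 0 := coe_translateDen_ne_zero x₀
  -- the power-series identities, coerced
  have i1 : D = Xs - algebraMap k k⸨X⸩ x₀ * t ^ 2 := by
    rw [hD, translateDen, PowerSeries.coe_sub, PowerSeries.coe_mul, PowerSeries.coe_pow, algebraMap_laurentSeries_eq_coe_C]
  have i3 : D * u = N := by
    rw [hD, hu, hN, ← PowerSeries.coe_mul, E.translateDen_mul_translateSlopeNum]
  have i4 : t ^ 2 * TX = G := by
    rw [htdef, hTX, hG, ← PowerSeries.coe_pow, ← PowerSeries.coe_mul, E.X_sq_mul_translateX]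
  have i5 : G = u ^ 2 - algebraMap k k⸨X⸩ E.a₁ * t * u - Xs - algebraMap k k⸨X⸩ (E.a₂ + x₀) * t ^ 2 := by
    rw [hG, translateXAux]
    simp only [PowerSeries.coe_sub, PowerSeries.coe_mul, PowerSeries.coe_pow, algebraMap_laurentSeries_eq_coe_C]
    rfl
  have i6 : t * H = TX - algebraMap k k⸨X⸩ x₀ := by
    rw [htdef, hH, hTX, ← PowerSeries.coe_mul, E.X_mul_translateXSubDivX, PowerSeries.coe_sub, algebraMap_laurentSeries_eq_coe_C]
  have i7 : TY = u * H - algebraMap k k⸨X⸩ y₀ - algebraMap k k⸨X⸩ E.a₁ * TX - algebraMap k k⸨X⸩ E.a₃ := by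
    rw [hTY, translateY_def']
    simp only [PowerSeries.coe_sub, PowerSeries.coe_mul, algebraMap_laurentSeries_eq_coe_C]
    rfl
  -- the chord
  have hx : algebraMap k k⸨X⸩ x₀ ≠ E.laurentX (PowerSeries.X : k⟦X⟧) := algebraMap_ne_laurentX_X x₀
  have hxd : algebraMap k k⸨X⸩ x₀ - E.laurentX (PowerSeries.X : k⟦X⟧) = -D / t ^ 2 := algebraMap_sub_laurentX_X x₀
  have hyd : algebraMap k k⸨X⸩ y₀ - E.laurentY (PowerSeries.X : k⟦X⟧) = N / t ^ 3 := algebraMap_sub_laurentY_X y₀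
  have hPt : E.laurentPt (PowerSeries.X : k⟦X⟧) PowerSeries.constantCoeff_X =
      .some _ _ (laurent_nonsingular PowerSeries.constantCoeff_X PowerSeries.X_ne_zero) :=
    laurentPt_of_ne_zero _ PowerSeries.X_ne_zero
  rw [hPt, Affine.Point.add_of_X_ne hx]
  -- `x₃ = translateX`
  have hX3 : (E.baseChange k⸨X⸩).toAffine.addX (algebraMap k k⸨X⸩ x₀) (E.laurentX PowerSeries.X)
      ((E.baseChange k⸨X⸩).toAffine.slope (algebraMap k k⸨X⸩ x₀) (E.laurentX PowerSeries.X) (algebraMap k k⸨X⸩ y₀)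
        (E.laurentY PowerSeries.X)) = TX := by
    have hc := chord_addX_mul (E.baseChange k⸨X⸩) (algebraMap k k⸨X⸩ y₀) (E.laurentY PowerSeries.X) hx
    have hne : (algebraMap k k⸨X⸩ x₀ - E.laurentX PowerSeries.X) ^ 2 ≠ 0 := pow_ne_zero 2 (sub_ne_zero.mpr hx)
    refine mul_right_cancel₀ hne (hc.trans ?_)
    simp only [baseChange, map_a₁, map_a₂]
    have hXsx : E.laurentX PowerSeries.X = algebraMap k k⸨X⸩ x₀ + D / t ^ 2 := by
      have := hxd; linear_combination -this
    rw [hyd, hxd, hXsx, show TX = G / t ^ 2 by rw [← i4]; field_simp, i5, ← i3]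
    field_simp
    rw [map_add, i1]
    ring
  -- `y₃ = translateY`
  have hY3 : (E.baseChange k⸨X⸩).toAffine.addY (algebraMap k k⸨X⸩ x₀) (E.laurentX PowerSeries.X) (algebraMap k k⸨X⸩ y₀)
      ((E.baseChange k⸨X⸩).toAffine.slope (algebraMap k k⸨X⸩ x₀) (E.laurentX PowerSeries.X) (algebraMap k k⸨X⸩ y₀)
        (E.laurentY PowerSeries.X)) = TY := by
    have hc := chord_addY_mul (E.baseChange k⸨X⸩) (algebraMap k k⸨X⸩ y₀) (E.laurentY PowerSeries.X) hx
    rw [hX3, show (E.baseChange k⸨X⸩).a₁ = algebraMap k k⸨X⸩ E.a₁ from rfl,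
      show (E.baseChange k⸨X⸩).a₃ = algebraMap k k⸨X⸩ E.a₃ from rfl] at hc
    have hne : algebraMap k k⸨X⸩ x₀ - E.laurentX PowerSeries.X ≠ 0 := sub_ne_zero.mpr hx
    -- `(y₃ + a₁x₃ + a₃)(x₀ − x(t)) = −(y₀ − y(t))(x₃ − x₀) − y₀(x₀ − x(t))` and the same for `TY`
    have hTYeq : (TY + algebraMap k k⸨X⸩ E.a₁ * TX + algebraMap k k⸨X⸩ E.a₃) *
        (algebraMap k k⸨X⸩ x₀ - E.laurentX PowerSeries.X) =
        -(algebraMap k k⸨X⸩ y₀ - E.laurentY PowerSeries.X) * (TX - algebraMap k k⸨X⸩ x₀) -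
          algebraMap k k⸨X⸩ y₀ * (algebraMap k k⸨X⸩ x₀ - E.laurentX PowerSeries.X) := by
      rw [hyd, hxd, ← i6, i7, ← i3]
      field_simp
      ring
    have h := hc.trans hTYeq.symm
    exact mul_right_cancel₀ hne (by linear_combination h)
  refine ⟨?_, ?_⟩
  · rw [← hX3, ← hY3]
    exact Affine.nonsingular_add (nonsingular_algebraMap_laurent h₀)
      (laurent_nonsingular PowerSeries.constantCoeff_X PowerSeries.X_ne_zero) fun h => hx h.1
  · simp only [hX3, hY3]

end WeierstrassCurve
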